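import Literature.Probability.LatticeModels.SahiThirdOrderCorrelation
import Mathlib.Combinatorics.SetFamily.FourFunctions
import Mathlib.Topology.Algebra.Order.Field
import Mathlib.Topology.Order.OrderClosed
import Mathlib.Analysis.SpecificLimits.Basic
import Mathlib.Tactic.Linarith
import Mathlib.Tactic.Ring
import HarnessLib
import HarnessLib.Audit

/-!
# `NoHeavyLowerTail` (crux stmt-CriticalPhenomena-4575), Sahi programme P4: strictly positive FKG weights are dense — removing the positivity
# hypothesis from cube inequalities

Support file (cell `prim-l12`, seat P4; `--supports stmt-CriticalPhenomena-4575`).  No named facts, no sorries; standard axioms.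

A nonnegative log-supermodular ("FKG") weight `μ` on the cube `Fin n → Bool` may vanish, and some arguments (the ratio-monotone layer cake of
`…SahiC3CubeFourFKGOrbit5D`) need `μ > 0`.  This file removes the restriction by a NOISE PERTURBATION: for `0 ≤ ε`,
`noisy μ ε x = Σ_y μ(y) · Π_i k_ε(y_i, x_i)` with `k_ε(s,t) = 1` if `s = t` and `ε` otherwise.  The kernel `(y,x) ↦ μ(y)·Π k_ε` is log-supermodular
on the product lattice for `ε ≤ 1` (`noiseKernel_lsm`), so its `x`-marginal `noisy μ ε` is log-supermodular by the four functions theorem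
(`lsm_marginal`, the marginal-closure of log-supermodularity [Karlin–Rinott 1980]); it is strictly positive as soon as `μ ≠ 0` and `ε > 0`, and
`noisy μ 0 = μ`.  Since `latticeE3 (noisy μ ε) U A B` is continuous in `ε`, an inequality `0 ≤ latticeE3 μ U A B` proved for all strictly positive
log-supermodular weights holds for all nonnegative ones (`latticeE3_nonneg_of_forall_pos`).
-/

namespace Summit.CriticalPhenomena.PercolationContinuityZ3.Theorems.SahiE3PositiveDensity

open Finset Filter Topology Literature.Probability.LatticeModels

/-! ### Marginals of log-supermodular functions (four functions theorem) -/

/-- **Marginal closure of log-supermodularity**: if `F ≥ 0` is log-supermodular on the product of two finite distributive lattices, then so is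
its marginal `x ↦ Σ_y F (x, y)` [Karlin–Rinott 1980, via Ahlswede–Daykin]. -/
theorem lsm_marginal {α β : Type*} [DistribLattice α] [DistribLattice β] [Fintype β] [DecidableEq β] {F : α × β → ℝ} (hF0 : ∀ p, 0 ≤ F p)
    (hF : ∀ p q, F p * F q ≤ F (p ⊓ q) * F (p ⊔ q)) (a b : α) :
    (∑ y, F (a, y)) * (∑ y, F (b, y)) ≤ (∑ y, F (a ⊓ b, y)) * (∑ y, F (a ⊔ b, y)) :=
  four_functions_theorem_univ (fun y => F (a, y)) (fun y => F (b, y)) (fun y => F (a ⊓ b, y)) (fun y => F (a ⊔ b, y))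
    (fun _ => hF0 _) (fun _ => hF0 _) (fun _ => hF0 _) (fun _ => hF0 _) (fun y y' => hF (a, y) (b, y'))

/-! ### The noise kernel -/

variable {n : ℕ}

/-- The one-coordinate noise kernel: `1` on the diagonal, `ε` off it. [this work] -/
def kε (ε : ℝ) (s t : Bool) : ℝ := if s = t then 1 else ε

/-- The one-coordinate kernel is log-supermodular on `Bool × Bool` for `0 ≤ ε ≤ 1`. [this work] -/
theorem kε_lsm {ε : ℝ} (h0 : 0 ≤ ε) (h1 : ε ≤ 1) (s s' t t' : Bool) :
    kε ε s t * kε ε s' t' ≤ kε ε (s && s') (t && t') * kε ε (s || s') (t || t') := by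
  have h2 : ε * ε ≤ 1 := by nlinarith
  cases s <;> cases s' <;> cases t <;> cases t' <;> simp [kε] <;> nlinarith

/-- `kε ε s t ≥ 0`. [this work] -/
theorem kε_nonneg {ε : ℝ} (h0 : 0 ≤ ε) (s t : Bool) : 0 ≤ kε ε s t := by
  unfold kε; split_ifs <;> [exact zero_le_one; exact h0]

/-- `kε ε s t ≥ ε` for `ε ≤ 1`. [this work] -/
theorem le_kε {ε : ℝ} (h1 : ε ≤ 1) (s t : Bool) : ε ≤ kε ε s t := by
  unfold kε; split_ifs <;> [exact h1; exact le_rfl]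

/-- The noise kernel on the cube: `K_ε(y, x) = Π_i k_ε(y_i, x_i) = ε^{#{i : y_i ≠ x_i}}`. [this work] -/
def noiseK (ε : ℝ) (y x : Fin n → Bool) : ℝ := ∏ i, kε ε (y i) (x i)

/-- The perturbed weight `noisy μ ε x = Σ_y μ(y) K_ε(y, x)`. [this work] -/
def noisy (μ : (Fin n → Bool) → ℝ) (ε : ℝ) (x : Fin n → Bool) : ℝ := ∑ y, μ y * noiseK ε y x

/-- `K_ε ≥ 0`. [this work] -/
theorem noiseK_nonneg {ε : ℝ} (h0 : 0 ≤ ε) (y x : Fin n → Bool) : 0 ≤ noiseK ε y x :=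
  Finset.prod_nonneg fun _ _ => kε_nonneg h0 _ _

/-- `K_ε ≥ ε^n` for `0 ≤ ε ≤ 1`. [this work] -/
theorem pow_le_noiseK {ε : ℝ} (h0 : 0 ≤ ε) (h1 : ε ≤ 1) (y x : Fin n → Bool) : ε ^ n ≤ noiseK ε y x := by
  unfold noiseK
  calc ε ^ n = ∏ _ : Fin n, ε := by simp
    _ ≤ ∏ i, kε ε (y i) (x i) := Finset.prod_le_prod (fun _ _ => h0) fun _ _ => le_kε h1 _ _

/-- `K_0(y, x) = [y = x]`. [this work] -/
theorem noiseK_zero (y x : Fin n → Bool) : noiseK 0 y x = if y = x then 1 else 0 := by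
  unfold noiseK kε
  rw [Fintype.prod_boole]
  congr 1
  exact propext ⟨fun h => funext h, fun h i => by rw [h]⟩

/-- `noisy μ 0 = μ`. [this work] -/
theorem noisy_zero (μ : (Fin n → Bool) → ℝ) : noisy μ 0 = μ := by
  funext x
  unfold noisy
  simp_rw [noiseK_zero, mul_ite, mul_one, mul_zero]
  rw [Finset.sum_ite_eq' univ x]; simp

/-- `noisy μ ε ≥ 0` for `μ, ε ≥ 0`. [this work] -/
theorem noisy_nonneg {μ : (Fin n → Bool) → ℝ} (hμ0 : 0 ≤ μ) {ε : ℝ} (h0 : 0 ≤ ε) (x : Fin n → Bool) : 0 ≤ noisy μ ε x :=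
  Finset.sum_nonneg fun y _ => mul_nonneg (hμ0 y) (noiseK_nonneg h0 y x)

/-- `noisy μ ε > 0` everywhere as soon as `μ ≥ 0` does not vanish identically and `0 < ε ≤ 1`. [this work] -/
theorem noisy_pos {μ : (Fin n → Bool) → ℝ} (hμ0 : 0 ≤ μ) {y₀ : Fin n → Bool} (hy₀ : 0 < μ y₀) {ε : ℝ} (h0 : 0 < ε) (h1 : ε ≤ 1)
    (x : Fin n → Bool) : 0 < noisy μ ε x := by
  unfold noisy
  calc (0 : ℝ) < μ y₀ * noiseK ε y₀ x := mul_pos hy₀ (lt_of_lt_of_le (pow_pos h0 n) (pow_le_noiseK h0.le h1 _ _))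
    _ ≤ ∑ y, μ y * noiseK ε y x :=
        Finset.single_le_sum (f := fun y => μ y * noiseK ε y x) (fun y _ => mul_nonneg (hμ0 y) (noiseK_nonneg h0.le y x)) (mem_univ y₀)

/-- The joint kernel `(y, x) ↦ μ(y) K_ε(y, x)` is log-supermodular on the product lattice for a log-supermodular `μ ≥ 0` and `0 ≤ ε ≤ 1`.
[this work] -/
theorem noiseKernel_lsm {μ : (Fin n → Bool) → ℝ} (hμ0 : 0 ≤ μ) (hμ : ∀ a b, μ a * μ b ≤ μ (a ⊓ b) * μ (a ⊔ b)) {ε : ℝ} (h0 : 0 ≤ ε)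
    (h1 : ε ≤ 1) (p q : (Fin n → Bool) × (Fin n → Bool)) :
    (μ p.2 * noiseK ε p.2 p.1) * (μ q.2 * noiseK ε q.2 q.1)
      ≤ (μ (p ⊓ q).2 * noiseK ε (p ⊓ q).2 (p ⊓ q).1) * (μ (p ⊔ q).2 * noiseK ε (p ⊔ q).2 (p ⊔ q).1) := by
  obtain ⟨x, y⟩ := p
  obtain ⟨x', y'⟩ := q
  simp only [Prod.mk_inf_mk, Prod.mk_sup_mk]
  have hK : noiseK ε y x * noiseK ε y' x' ≤ noiseK ε (y ⊓ y') (x ⊓ x') * noiseK ε (y ⊔ y') (x ⊔ x') := by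
    unfold noiseK
    rw [← Finset.prod_mul_distrib, ← Finset.prod_mul_distrib]
    exact Finset.prod_le_prod (fun i _ => mul_nonneg (kε_nonneg h0 _ _) (kε_nonneg h0 _ _)) fun i _ => kε_lsm h0 h1 _ _ _ _
  calc μ y * noiseK ε y x * (μ y' * noiseK ε y' x') = (μ y * μ y') * (noiseK ε y x * noiseK ε y' x') := by ring
    _ ≤ (μ (y ⊓ y') * μ (y ⊔ y')) * (noiseK ε (y ⊓ y') (x ⊓ x') * noiseK ε (y ⊔ y') (x ⊔ x')) :=
        mul_le_mul (hμ y y') hK (mul_nonneg (noiseK_nonneg h0 _ _) (noiseK_nonneg h0 _ _)) (mul_nonneg (hμ0 _) (hμ0 _))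
    _ = μ (y ⊓ y') * noiseK ε (y ⊓ y') (x ⊓ x') * (μ (y ⊔ y') * noiseK ε (y ⊔ y') (x ⊔ x')) := by ring

/-- **`noisy μ ε` is log-supermodular** for a log-supermodular `μ ≥ 0` and `0 ≤ ε ≤ 1` (marginal closure). [this work] -/
theorem noisy_lsm {μ : (Fin n → Bool) → ℝ} (hμ0 : 0 ≤ μ) (hμ : ∀ a b, μ a * μ b ≤ μ (a ⊓ b) * μ (a ⊔ b)) {ε : ℝ} (h0 : 0 ≤ ε)
    (h1 : ε ≤ 1) (a b : Fin n → Bool) : noisy μ ε a * noisy μ ε b ≤ noisy μ ε (a ⊓ b) * noisy μ ε (a ⊔ b) :=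
  lsm_marginal (F := fun p : (Fin n → Bool) × (Fin n → Bool) => μ p.2 * noiseK ε p.2 p.1)
    (fun _ => mul_nonneg (hμ0 _) (noiseK_nonneg h0 _ _)) (noiseKernel_lsm hμ0 hμ h0 h1) a b

/-! ### Continuity in `ε` and the density argument -/

/-- `ε ↦ K_ε(y, x)` is continuous. [this work] -/
theorem continuous_noiseK (y x : Fin n → Bool) : Continuous fun ε : ℝ => noiseK ε y x := by
  unfold noiseK
  refine continuous_finsetProd _ fun i _ => ?_
  unfold kε
  split_ifs
  · exact continuous_const
  · exact continuous_id

/-- `ε ↦ noisy μ ε x` is continuous. [this work] -/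
theorem continuous_noisy (μ : (Fin n → Bool) → ℝ) (x : Fin n → Bool) : Continuous fun ε : ℝ => noisy μ ε x := by
  unfold noisy
  exact continuous_finsetSum _ fun y _ => continuous_const.mul (continuous_noiseK y x)

/-- `ε ↦ mass (noisy μ ε) A` is continuous. [this work] -/
theorem continuous_mass_noisy (μ : (Fin n → Bool) → ℝ) (A : Finset (Fin n → Bool)) :
    Continuous fun ε : ℝ => mass (noisy μ ε) A := by
  unfold mass
  exact continuous_finsetSum _ fun x _ => continuous_noisy μ x

/-- `ε ↦ latticeE3 (noisy μ ε) U A B` is continuous. [this work] -/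
theorem continuous_latticeE3_noisy (μ : (Fin n → Bool) → ℝ) (U A B : Finset (Fin n → Bool)) :
    Continuous fun ε : ℝ => latticeE3 (noisy μ ε) U A B := by
  unfold latticeE3
  have h := continuous_mass_noisy μ
  exact (((continuous_const.mul ((h _).pow 2)).mul (h _)).add (((h _).mul (h _)).mul (h _))).sub
    ((h _).mul ((((h _).mul (h _)).add ((h _).mul (h _))).add ((h _).mul (h _))))

/-- `latticeE3` of the zero weight vanishes. [this work] -/
theorem latticeE3_zero_weight (U A B : Finset (Fin n → Bool)) : latticeE3 (fun _ : Fin n → Bool => (0 : ℝ)) U A B = 0 := by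
  simp [latticeE3, mass]

/-- **Density of strictly positive FKG weights**: an inequality `0 ≤ latticeE3 μ U A B` proved for every strictly positive log-supermodular weight
on the cube holds for every nonnegative log-supermodular weight. [this work] -/
theorem latticeE3_nonneg_of_forall_pos {U A B : Finset (Fin n → Bool)}
    (h : ∀ μ : (Fin n → Bool) → ℝ, (∀ x, 0 < μ x) → (∀ a b, μ a * μ b ≤ μ (a ⊓ b) * μ (a ⊔ b)) → 0 ≤ latticeE3 μ U A B)
    (μ : (Fin n → Bool) → ℝ) (hμ0 : 0 ≤ μ) (hμ : ∀ a b, μ a * μ b ≤ μ (a ⊓ b) * μ (a ⊔ b)) : 0 ≤ latticeE3 μ U A B := by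
  by_cases hz : ∃ y₀, 0 < μ y₀
  · obtain ⟨y₀, hy₀⟩ := hz
    have hev : ∀ᶠ ε in 𝓝[>] (0 : ℝ), 0 ≤ latticeE3 (noisy μ ε) U A B := by
      filter_upwards [Ioo_mem_nhdsGT (zero_lt_one' ℝ)] with ε hε
      exact h _ (noisy_pos hμ0 hy₀ hε.1 hε.2.le) (noisy_lsm hμ0 hμ hε.1.le hε.2.le)
    have hlim : Tendsto (fun ε : ℝ => latticeE3 (noisy μ ε) U A B) (𝓝[>] 0) (𝓝 (latticeE3 (noisy μ 0) U A B)) :=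
      ((continuous_latticeE3_noisy μ U A B).tendsto 0).mono_left nhdsWithin_le_nhds
    rw [noisy_zero] at hlim
    exact ge_of_tendsto hlim hev
  · push Not at hz
    have hμz : μ = fun _ => 0 := funext fun y => le_antisymm (hz y) (hμ0 y)
    rw [hμz, latticeE3_zero_weight]

end Summit.CriticalPhenomena.PercolationContinuityZ3.Theorems.SahiE3PositiveDensity
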